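import Literature.NumberTheory.LFunctions.FordProgram1
import HarnessLib

/-!
# Ford's "Program 1": kernel run 10C (`585 ≤ k ≤ 593`)

Topic `Literature/NumberTheory/LFunctions`. Everything here is PROVED (kernel evaluations, standard
axioms): `FordP1.checkT k = true` for `585 ≤ k ≤ 593`, i.e. the certified re-run of PROGRAM 1 of
K. Ford, Proc. LMS 85 (2002) (the second part of Theorem 3) for these `k` — see `FordProgram1.lean`
for the checker, its soundness `FordP1.row_of_checkK`, and the meaning of the constants
(`ρ = FordP1.rhoOf k / 10⁵`, `θ = FordP1.thetaOf k / 10⁴`, `ω = FordP1.omOf k / 10⁴`). One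
`decide +kernel` per `k` (so that the kernel's evaluation state is bounded by a single run;
`maxHeartbeats 0` lifts the deterministic time-out for each), then the range statement
`FordP1.run10C`. The three parts 10A–10C are re-assembled in the original `List.all` form as
`FordP1.run10` (`FordProgram1Run10.lean`), which the assembly `FordTheorem3SmallK.lean` uses.

## References

* K. Ford, Proc. London Math. Soc. (3) 85 (2002), 565–633; arXiv:1910.08209: Theorem 3, (1.7),
  Lemmas 3.4–3.5, Appendix "PROGRAM 1". [Ford2002]
-/

namespace Literature.NumberTheory.LFunctions
namespace FordP1

set_option maxHeartbeats 0 in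
/-- `checkT 585`. [cite: Ford2002, Theorem 3 (second part) and PROGRAM 1] -/
theorem checkT_585 : checkT 585 = true := by
  decide +kernel

set_option maxHeartbeats 0 in
/-- `checkT 586`. [cite: Ford2002, Theorem 3 (second part) and PROGRAM 1] -/
theorem checkT_586 : checkT 586 = true := by
  decide +kernel

set_option maxHeartbeats 0 in
/-- `checkT 587`. [cite: Ford2002, Theorem 3 (second part) and PROGRAM 1] -/
theorem checkT_587 : checkT 587 = true := by
  decide +kernel

set_option maxHeartbeats 0 in
/-- `checkT 588`. [cite: Ford2002, Theorem 3 (second part) and PROGRAM 1] -/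
theorem checkT_588 : checkT 588 = true := by
  decide +kernel

set_option maxHeartbeats 0 in
/-- `checkT 589`. [cite: Ford2002, Theorem 3 (second part) and PROGRAM 1] -/
theorem checkT_589 : checkT 589 = true := by
  decide +kernel

set_option maxHeartbeats 0 in
/-- `checkT 590`. [cite: Ford2002, Theorem 3 (second part) and PROGRAM 1] -/
theorem checkT_590 : checkT 590 = true := by
  decide +kernel

set_option maxHeartbeats 0 in
/-- `checkT 591`. [cite: Ford2002, Theorem 3 (second part) and PROGRAM 1] -/
theorem checkT_591 : checkT 591 = true := by
  decide +kernel

set_option maxHeartbeats 0 in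
/-- `checkT 592`. [cite: Ford2002, Theorem 3 (second part) and PROGRAM 1] -/
theorem checkT_592 : checkT 592 = true := by
  decide +kernel

set_option maxHeartbeats 0 in
/-- `checkT 593`. [cite: Ford2002, Theorem 3 (second part) and PROGRAM 1] -/
theorem checkT_593 : checkT 593 = true := by
  decide +kernel

/-- **Kernel run 10C**: `checkT k` for `585 ≤ k ≤ 593`. [cite: Ford2002, Theorem 3 (second part)
and PROGRAM 1] -/
theorem run10C (k : ℕ) (h1 : 585 ≤ k) (h2 : k ≤ 593) : checkT k = true := by
  interval_cases k
  · exact checkT_585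
  · exact checkT_586
  · exact checkT_587
  · exact checkT_588
  · exact checkT_589
  · exact checkT_590
  · exact checkT_591
  · exact checkT_592
  · exact checkT_593

end FordP1
end Literature.NumberTheory.LFunctions
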